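import Literature.Computability.Complexity.Mod2SymmetricPseudoexpectationInterpolation
import Literature.Computability.Complexity.Mod2StoryPseudoexpectation
import Literature.Computability.Complexity.MatchingOddCutSosDegree
import Literature.Computability.Complexity.SumOfSquaresRefutationDuality
import HarnessLib

/-!
# Potechin's Theorem 1.2 in its printed (refutation) form, with explicit ranges:
# the story functional of `MOD2_N` kills static sum-of-squares refutations

Source: A. Potechin, *Sum of squares lower bounds from symmetry and a good story*, ITCS 2019, LIPIcs
124, 61:1–61:20 = arXiv:1711.11469 (held `paper:arxiv-1711.11469`; "p. n" = arXiv page) [Potechin2019];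
D. Grigoriev, Theoret. Comput. Sci. 259 (2001) 613–622, Cor. 2 [Grigoriev2001TCS]; G. Braun et al.,
*The matching problem has no small symmetric SDP*, Math. Program. 165 (2017), §4.5 [BraunEtAl2016].

## What is printed

* **Theorem 1.2** (p. 4, verbatim): "Degree `(n−1)/2` SOS fails to prove that the equations for the
  MOD 2 principle are infeasible."  The MOD 2 equations (p. 3): `x_{ij}² − x_{ij} = 0`,
  `x_{ij} x_{ik} = 0` (p. 7, Example 3.4: edges sharing a vertex), `Σ_{j ≠ i} x_{ij} − 1 = 0` — the
  tree's `Mod2.system n` (`Mod2SosDegree.lean`, Grigoriev's `MOD2_n`).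
* **Definition 2.10** (p. 5): a degree-`d` refutation is `−1 = Σ_i f_i s_i + Σ_j g_j²` with
  `deg f_i + deg s_i ≤ d`, `deg g_j ≤ d/2`; **Definition 2.14 / Proposition 2.15** (p. 6): degree-`d`
  pseudo-expectation values (`Ẽ[1] = 1`, `Ẽ[f s_i] = 0` for `deg f + deg s_i ≤ d`, `Ẽ[g²] ≥ 0` for
  `deg g ≤ d/2`) exclude degree-`d` refutations; **Example 3.4** (p. 7): the story values
  `Ẽ[x_E] = [E partial matching]·∏_{j=1}^{|E|} (n − 2j + 1)⁻¹`; **Corollary 3.10** (p. 9): "For all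
  positive odd integers `n`, index degree `n` SOS fails to refute the equations for the MOD 2 principle."

DEGREE DICTIONARY.  The tree's `HasSOSRefutation S d` (`SumOfSquaresRefutation.lean`) has squares
`q_l²` with `deg q_l ≤ d` and products `g_e · S e` of degree `≤ 2d`, i.e. it is a Potechin/Grigoriev
refutation of degree `2d`.  Hence Theorem 1.2 reads: for odd `n`, `¬ HasSOSRefutation (Mod2.system n) d`
whenever `2d ≤ (n − 1)/2`, i.e. `4d + 1 ≤ n`.

## What this file proves (no named facts, no new definitions of notions — only the functional)

The tree holds (a) the NAMED FACT `Mod2Story.Potechin2019_mod2StoryPSD` (`Mod2StoryPseudoexpectation.lean`: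
the story moment matrix is PSD on index degree `≤ (n−1)/2`; printed proof gapped, repaired on paper,
see that file) and (b) the THEOREM `PseudoMatching.storyForm_nonneg` (`…Interpolation.lean`, cell
pnp-psdrank littype-FN2-1 g8): the story moment form on edge-degree `≤ k` is PSD for odd `N`, `6k ≤ N`.
Both are statements about a quadratic form.  Here we build the story FUNCTIONAL
`storyFunctional N : ℝ[X_e : e ∈ E(K_N)] →ₗ ℝ` (`X^α ↦ Ẽ[x_{supp α}]`, Example 3.4), verify directly
that it annihilates the MOD 2 ideal below the top level (Booleanity and disjointness for all
multipliers; the vertex equations `Σ_{e ∋ i} X_e − 1` for multipliers of degree `≤ (N−3)/2` — this is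
the MOD 2 case of Potechin's Thm 5.12 (1), p. 13, done by the one-line computation
`(N − 1 − 2|S|)·μ_N(|S|+1) = μ_N(|S|)`), identify `Ẽ[q²]` with the story moment form of the multilinear
coefficient vector of `q`, and conclude by weak duality (`not_hasSOSRefutation_of_functional'`,
Prop. 2.15):

* `PseudoMatching.not_hasSOSRefutation_mod2` — **UNCONDITIONAL**: for odd `N ≥ 3` and `6d ≤ N`,
  `MOD2_N` has no static SOS refutation of half-degree `d` (Theorem 1.2 in the range the tree proves);
* `PseudoMatching.not_hasSOSRefutation_mod2_of_potechin` — **Theorem 1.2 verbatim** (`4d + 1 ≤ N`)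
  from the named fact `Potechin2019_mod2StoryPSD`;
* `PseudoMatching.lt_of_hasSOSRefutation_mod2` — **Grigoriev's Corollary 2 with an explicit constant**:
  for every `n ≥ 2`, a half-degree-`d` refutation of `MOD2_n` forces `n < 6d` (even `n`: the system is
  satisfiable, `Mod2.exists_common_zero_of_even`); in the fact's currency `Grigoriev2001_mod2Degree_oneThird`: `n/3 ≤ 2d` for all `n ≥ 2`,
  i.e. the body of `Grigoriev2001_mod2Degree` with `c = 1/3`, `n₀ = 2` (the tree's discharge
  `Grigoriev2001_mod2Degree_holds` via Tseitin on explicit expanders has `c = 9/(160·631¹⁶·(1 + 2 dX))`);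
* `card_lt_of_hasSOSCertificate_cutPoly` and `oddCutSOSDegreeLinear_oneThird` — the
  cell's Rung 1 (`MatchingOddCutSosDegree.lean`, BBCHPRRWZ §4.5: SOS certificates of the odd-cut
  inequalities `x(δ(U)) ≥ 1` from the matching constraints of `K_n`) with explicit constant and no
  threshold: `|U| < 6d` for every `U` with `2 ≤ |U|`, `2|U| ≤ n`; `|U| ≤ 4d` under the Potechin fact.

The threshold `N ≥ 3` (resp. `n ≥ 2`) is necessary: `MOD2_1` (one vertex, no edges, the equation
`−1 = 0`) is refutable in half-degree `0` (the `example` in `Mod2SosDegree.lean`).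

## References

* A. Potechin, ITCS 2019, LIPIcs 124:61, Thm 1.2 (p. 4), Def 2.10 (p. 5), Def 2.14, Prop 2.15 (p. 6),
  Ex 3.4 (p. 7), Cor 3.10 (p. 9), Thm 5.12 (p. 13). [Potechin2019]
* D. Grigoriev, Theoret. Comput. Sci. 259 (2001) 613–622, Cor. 2 (p. 622). [Grigoriev2001TCS]
* G. Braun, J. Brown-Cohen, A. Huq, S. Pokutta, P. Raghavendra, A. Roy, B. Weitz, D. Zink,
  Math. Program. 165 (2017), §4.5. [BraunEtAl2016]
-/

noncomputable section

open MvPolynomial Finset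

namespace Literature.Computability.Complexity

namespace PseudoMatching

variable {N : ℕ}

/-! ### §1 The edge support of a monomial -/

/-- The set `E_p` of edges of `K_N` occurring in the monomial `p = X^α` (as pairs in `Sym2 (Fin N)`;
Potechin's "`p = ∏_{e ∈ E_p} x_e`"); the story value of `X^α` only depends on it (`x_e² = x_e`).
[cite: Potechin2019, Def. 2.6 (p. 5) and Example 3.4 (p. 7)] -/
def edgeSupport (α : KnEdge N →₀ ℕ) : Finset (Sym2 (Fin N)) :=
  α.support.map (Function.Embedding.subtype _)

/-- Membership of an edge of `K_N` in the edge support. [cite: Potechin2019, Example 3.4 (p. 7)] -/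
theorem coe_mem_edgeSupport {α : KnEdge N →₀ ℕ} {e : KnEdge N} :
    (e : Sym2 (Fin N)) ∈ edgeSupport α ↔ e ∈ α.support := by
  rw [edgeSupport, Finset.mem_map]
  constructor
  · rintro ⟨f, hf, hfe⟩
    have : f = e := Subtype.ext (by simpa using hfe)
    exact this ▸ hf
  · exact fun he => ⟨e, he, rfl⟩

/-- Membership in the edge support. [cite: Potechin2019, Example 3.4 (p. 7)] -/
theorem mem_edgeSupport {α : KnEdge N →₀ ℕ} {e : Sym2 (Fin N)} :
    e ∈ edgeSupport α ↔ ∃ h : ¬ e.IsDiag, (⟨e, h⟩ : KnEdge N) ∈ α.support := by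
  constructor
  · intro he
    obtain ⟨f, hf, rfl⟩ := Finset.mem_map.1 he
    exact ⟨f.2, hf⟩
  · rintro ⟨h, hmem⟩
    exact coe_mem_edgeSupport.2 hmem

/-- Edge supports consist of edges (no loops). [cite: Potechin2019, Example 3.4 (p. 7)] -/
theorem not_isDiag_of_mem_edgeSupport {α : KnEdge N →₀ ℕ} {e : Sym2 (Fin N)}
    (he : e ∈ edgeSupport α) : ¬ e.IsDiag := by
  obtain ⟨h, -⟩ := mem_edgeSupport.1 he
  exact h

/-- The edge support has as many elements as the support. [cite: Potechin2019, Def. 2.6 (p. 5)] -/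
theorem card_edgeSupport (α : KnEdge N →₀ ℕ) : (edgeSupport α).card = α.support.card := by
  rw [edgeSupport, card_map]

/-- Supports add as unions for exponent vectors. [folklore] -/
private theorem support_add_eq_union (α β : KnEdge N →₀ ℕ) : (α + β).support = α.support ∪ β.support := by
  ext i
  simp only [Finsupp.mem_support_iff, Finsupp.add_apply, ne_eq, Nat.add_eq_zero_iff, mem_union]
  tauto

/-- `supp (α + β) = supp α ∪ supp β` on edges (multilinear reduction `x_A x_B = x_{A ∪ B}`).
[cite: Potechin2019, Remark 2.16 (p. 6)] -/
theorem edgeSupport_add (α β : KnEdge N →₀ ℕ) :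
    edgeSupport (α + β) = edgeSupport α ∪ edgeSupport β := by
  rw [edgeSupport, support_add_eq_union, map_union]; rfl

/-- The constant monomial has empty edge set `E_1 = ∅`. [cite: Potechin2019, Def. 2.6 (p. 5)] -/
@[simp] theorem edgeSupport_zero : edgeSupport (0 : KnEdge N →₀ ℕ) = ∅ := by
  simp [edgeSupport]

/-- The edge set of a power `X_e^k`, `k ≠ 0`, is `E_p = {e}`. [cite: Potechin2019, Def. 2.6 (p. 5)] -/
theorem edgeSupport_single (e : KnEdge N) {k : ℕ} (hk : k ≠ 0) :
    edgeSupport (Finsupp.single e k) = {(e : Sym2 (Fin N))} := by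
  rw [edgeSupport, Finsupp.support_single _ hk, map_singleton]; rfl

/-- The number of edges of a monomial is at most its degree, hence at most the total degree of
any polynomial containing it. [folklore] -/
private theorem card_edgeSupport_le_totalDegree {p : MvPolynomial (KnEdge N) ℝ} {α : KnEdge N →₀ ℕ}
    (hα : α ∈ p.support) : (edgeSupport α).card ≤ p.totalDegree := by
  rw [card_edgeSupport]
  refine le_trans ?_ (le_totalDegree hα)
  rw [Finsupp.sum, Finset.card_eq_sum_ones]
  exact Finset.sum_le_sum fun i hi => Nat.one_le_iff_ne_zero.mpr (Finsupp.mem_support_iff.mp hi)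

/-! ### §2 The story functional on `ℝ[X_e : e ∈ E(K_N)]` -/

/-- **The story functional** `Ẽ` of `MOD2_N`: the linear functional on `ℝ[X_e : e ∈ E(K_N)]` with
`Ẽ[X^α] = Ẽ[x_{supp α}] = storyValue N (supp α)` (`= μ_N(|supp α|)` if the edges of `α` form a
partial matching, `0` otherwise). [cite: Potechin2019, Example 3.4 (p. 7) and Def. 2.14 (p. 6)] -/
def storyFunctional (N : ℕ) : MvPolynomial (KnEdge N) ℝ →ₗ[ℝ] ℝ :=
  Finsupp.linearCombination ℝ (fun α : KnEdge N →₀ ℕ => storyValue N (edgeSupport α)) ∘ₗ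
    (AddMonoidAlgebra.coeffLinearEquiv ℝ : AddMonoidAlgebra ℝ (KnEdge N →₀ ℕ) ≃ₗ[ℝ] _).toLinearMap

/-- Value on a monomial: `Ẽ[c X^α] = c · storyValue N (supp α)`. [cite: Potechin2019, Example 3.4 (p. 7)] -/
theorem storyFunctional_monomial (α : KnEdge N →₀ ℕ) (c : ℝ) :
    storyFunctional N (monomial α c) = c * storyValue N (edgeSupport α) := by
  simp [storyFunctional, monomial]

/-- The empty edge set is a partial matching. [cite: Potechin2019, Example 3.4 (p. 7)] -/
theorem isPartialMatching_empty : IsPartialMatching (∅ : Finset (Sym2 (Fin N))) :=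
  ⟨fun e he => absurd he (Finset.notMem_empty e), fun v => by simp⟩

/-- `Ẽ[1] = 1`. [cite: Potechin2019, Def. 2.14 (1) (p. 6)] -/
theorem storyFunctional_one : storyFunctional N 1 = 1 := by
  rw [show (1 : MvPolynomial (KnEdge N) ℝ) = monomial 0 1 from rfl, storyFunctional_monomial,
    edgeSupport_zero, storyValue_of isPartialMatching_empty, card_empty, moment_zero, mul_one]

/-- Value on a product, monomial by monomial. [cite: Potechin2019, Remark 2.16 (p. 6)] -/
theorem storyFunctional_mul (p q : MvPolynomial (KnEdge N) ℝ) :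
    storyFunctional N (p * q) = ∑ α ∈ p.support, ∑ β ∈ q.support,
      coeff α p * coeff β q * storyValue N (edgeSupport α ∪ edgeSupport β) := by
  classical
  conv_lhs => rw [p.as_sum, q.as_sum, sum_mul]
  rw [map_sum]
  refine sum_congr rfl fun α _ => ?_
  rw [mul_sum, map_sum]
  refine sum_congr rfl fun β _ => ?_
  rw [monomial_mul, storyFunctional_monomial, edgeSupport_add]

/-! ### §3 The functional annihilates the MOD 2 ideal below the top level -/

/-- **Booleanity**: `Ẽ[(X_e² − X_e) · g] = 0` for every `g` (the functional only sees edge supports).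
[cite: Potechin2019, §1.2 (p. 3, the equations x² − x = 0) and Example 3.4 (p. 7)] -/
theorem storyFunctional_bool_mul (e : KnEdge N) (g : MvPolynomial (KnEdge N) ℝ) :
    storyFunctional N ((X e ^ 2 - X e) * g) = 0 := by
  classical
  conv_lhs => rw [g.as_sum, mul_sum]
  rw [map_sum]
  refine sum_eq_zero fun β _ => ?_
  have hX : (X e : MvPolynomial (KnEdge N) ℝ) = monomial (Finsupp.single e 1) 1 := rfl
  have hX2 : (X e ^ 2 : MvPolynomial (KnEdge N) ℝ) = monomial (Finsupp.single e 2) 1 := by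
    rw [hX, monomial_pow]; simp
  rw [sub_mul, hX2, hX, monomial_mul, monomial_mul, map_sub, storyFunctional_monomial,
    storyFunctional_monomial, edgeSupport_add, edgeSupport_add, edgeSupport_single e two_ne_zero,
    edgeSupport_single e one_ne_zero, sub_self]

/-- Two distinct edges at a common vertex never lie in a partial matching.
[cite: Potechin2019, Example 3.4 (p. 7)] -/
theorem not_isPartialMatching_of_two_mem {G : Finset (Sym2 (Fin N))} {e f : Sym2 (Fin N)}
    (he : e ∈ G) (hf : f ∈ G) (hef : e ≠ f) {i : Fin N} (hie : i ∈ e) (hif : i ∈ f) :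
    ¬ IsPartialMatching G := by
  rintro ⟨-, h1⟩
  have h2 : 2 ≤ (G.filter fun e => i ∈ e).card := by
    have hsub : ({e, f} : Finset (Sym2 (Fin N))) ⊆ G.filter fun e => i ∈ e := by
      intro x hx
      rcases mem_insert.1 hx with rfl | hx
      · exact mem_filter.2 ⟨he, hie⟩
      · rw [mem_singleton.1 hx]; exact mem_filter.2 ⟨hf, hif⟩
    have := card_le_card hsub
    rwa [card_pair hef] at this
  have := h1 i
  omega

/-- **Disjointness**: `Ẽ[X_e X_f · g] = 0` for distinct edges `e ≠ f` sharing a vertex and every `g`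
(every monomial of the product contains two edges at a common vertex, hence is not a partial
matching). [cite: Potechin2019, Example 3.4 (p. 7, "Ẽ = 0 otherwise")] -/
theorem storyFunctional_pair_mul (e f : KnEdge N) (hef : e ≠ f) {i : Fin N}
    (hie : i ∈ (e : Sym2 (Fin N))) (hif : i ∈ (f : Sym2 (Fin N))) (g : MvPolynomial (KnEdge N) ℝ) :
    storyFunctional N (X e * X f * g) = 0 := by
  classical
  conv_lhs => rw [g.as_sum, mul_sum]
  rw [map_sum]
  refine sum_eq_zero fun β _ => ?_
  have hX : ∀ e : KnEdge N, (X e : MvPolynomial (KnEdge N) ℝ) = monomial (Finsupp.single e 1) 1 :=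
    fun e => rfl
  rw [hX, hX, monomial_mul, monomial_mul, storyFunctional_monomial, edgeSupport_add, edgeSupport_add,
    edgeSupport_single e one_ne_zero, edgeSupport_single f one_ne_zero]
  have hne : (e : Sym2 (Fin N)) ≠ (f : Sym2 (Fin N)) := fun h => hef (Subtype.ext h)
  rw [storyValue_of_not (not_isPartialMatching_of_two_mem (e := (e : Sym2 (Fin N)))
    (f := (f : Sym2 (Fin N))) (by simp) (by simp) hne hie hif), mul_zero]

/-- The vertex polynomial `Σ_{e ∋ i} X_e − 1` of `MOD2_N`. [cite: Potechin2019, §1.2 (p. 3)] -/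
theorem system_vertex_eq (i : Fin N) :
    Mod2.system N (Sum.inr (Sum.inr i)) =
      (∑ e ∈ univ.filter (fun e : KnEdge N => i ∈ (e : Sym2 (Fin N))), X e) - 1 := rfl

/-- **The vertex equations on monomials** (the MOD 2 case of the story's well-definedness,
Thm 5.12 (1)): `Ẽ[(Σ_{e ∋ i} X_e − 1) · c X^β] = 0` whenever `2|supp β| + 2 ≤ N`.  With
`S = supp β`: if `S` is not a partial matching every term vanishes; if `i` is covered by the edge
`e₀ ∈ S`, only `e = e₀` contributes, with `Ẽ[x_S]`; if `i` is uncovered, exactly the `N − 1 − 2|S|`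
edges from `i` to uncovered vertices contribute `μ_N(|S|+1) = μ_N(|S|)/(N − 1 − 2|S|)` each.
[cite: Potechin2019, Example 3.4 (p. 7) and Thm 5.12 (1) (p. 13)] -/
theorem storyFunctional_vertex_mul_monomial (i : Fin N) {β : KnEdge N →₀ ℕ}
    (hβ : 2 * (edgeSupport β).card + 2 ≤ N) (c : ℝ) :
    storyFunctional N (((∑ e ∈ univ.filter (fun e : KnEdge N => i ∈ (e : Sym2 (Fin N))), X e) - 1) *
      monomial β c) = 0 := by
  classical
  set S := edgeSupport β with hS
  have hX : ∀ e : KnEdge N, (X e : MvPolynomial (KnEdge N) ℝ) = monomial (Finsupp.single e 1) 1 :=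
    fun e => rfl
  -- expand the product
  have hexp : storyFunctional N (((∑ e ∈ univ.filter (fun e : KnEdge N => i ∈ (e : Sym2 (Fin N))), X e)
      - 1) * monomial β c) =
      c * ((∑ a ∈ univ.erase i, storyValue N (insert s(i, a) S)) - storyValue N S) := by
    rw [sub_mul, one_mul, map_sub, storyFunctional_monomial, sum_mul, map_sum]
    simp_rw [hX, monomial_mul, storyFunctional_monomial, one_mul, edgeSupport_add]
    rw [KnEdge.sum_filter_mem i (fun e : KnEdge N => c * storyValue N (edgeSupport (Finsupp.single e 1) ∪ S))]
    simp_rw [edgeSupport_single _ one_ne_zero, KnEdge.coe_edgeAt, singleton_union]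
    rw [mul_sub, mul_sum]
    congr 1
    symm
    exact sum_subtype (univ.erase i) (fun a => by simp) (fun a : Fin N => c * storyValue N (insert s(i, a) S))
  rw [hexp]
  suffices h : ∑ a ∈ univ.erase i, storyValue N (insert s(i, a) S) = storyValue N S by
    rw [h, sub_self, mul_zero]
  by_cases hpm : IsPartialMatching S
  swap
  · -- not a partial matching: everything vanishes
    rw [storyValue_of_not hpm]
    refine sum_eq_zero fun a _ => storyValue_of_not fun h => hpm (h.subset (subset_insert _ _))
  by_cases hi : i ∈ verts S
  · -- `i` is covered by an edge `e₀ = s(i, a₀)` of `S`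
    obtain ⟨e₀, he₀S, hie₀⟩ := mem_verts.1 hi
    set a₀ : Fin N := Sym2.Mem.other hie₀ with ha₀
    have he₀ : s(i, a₀) = e₀ := Sym2.other_spec hie₀
    have ha₀i : a₀ ≠ i := by
      intro h
      have hdiag : e₀.IsDiag := by rw [← he₀, h]; exact Sym2.mk_isDiag_iff.2 rfl
      exact hpm.1 e₀ he₀S hdiag
    rw [sum_eq_single_of_mem a₀ (mem_erase.2 ⟨ha₀i, mem_univ _⟩)]
    · rw [he₀, insert_eq_of_mem he₀S]
    · intro a ha hne
      refine storyValue_of_not (not_isPartialMatching_of_two_mem (e := s(i, a)) (f := e₀)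
        (mem_insert_self _ _) (mem_insert_of_mem he₀S) ?_ (Sym2.mem_mk_left _ _) hie₀)
      intro h
      apply hne
      have : s(i, a) = s(i, a₀) := h.trans he₀.symm
      exact Sym2.congr_right.1 this
  · -- `i` is uncovered: the edges to uncovered vertices contribute `μ(|S|+1)` each
    have hval : ∀ a ∈ univ.erase i, storyValue N (insert s(i, a) S) =
        if a ∈ verts S then 0 else moment N (S.card + 1) := by
      intro a ha
      have hai : a ≠ i := (mem_erase.1 ha).1
      split_ifs with haS
      · obtain ⟨f, hfS, haf⟩ := mem_verts.1 haS
        have hne : s(i, a) ≠ f := by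
          intro h; exact hi (mem_verts.2 ⟨f, hfS, h ▸ Sym2.mem_mk_left _ _⟩)
        exact storyValue_of_not (not_isPartialMatching_of_two_mem (mem_insert_self _ _)
          (mem_insert_of_mem hfS) hne (Sym2.mem_mk_right _ _) haf)
      · have hnot : s(i, a) ∉ S := fun h => hi (mem_verts.2 ⟨_, h, Sym2.mem_mk_left _ _⟩)
        rw [storyValue_of (hpm.insert_edge hai.symm hi haS), card_insert_of_notMem hnot]
    rw [sum_congr rfl hval, sum_ite, sum_const_zero, zero_add, sum_const, nsmul_eq_mul]
    have hcount : ((univ.erase i).filter fun a => a ∉ verts S).card = N - 1 - 2 * S.card := by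
      have : ((univ.erase i).filter fun a => a ∉ verts S) = (insert i (verts S))ᶜ := by
        ext a; simp [mem_erase, and_comm]
      rw [this, card_compl, Fintype.card_fin, card_insert_of_notMem hi, hpm.card_verts]
      omega
    have hverts : 2 * S.card + 1 ≤ N := by omega
    rw [hcount, storyValue_of hpm, moment_succ]
    have hne : ((N : ℝ) - 1 - 2 * S.card) ≠ 0 := by
      have : ((2 * S.card + 2 : ℕ) : ℝ) ≤ N := by exact_mod_cast hβ
      push_cast at this
      intro h; linarith
    rw [Nat.cast_sub (by omega), Nat.cast_sub (by omega)]
    push_cast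
    field_simp

/-- **The vertex equations**: `Ẽ[(Σ_{e ∋ i} X_e − 1) · g] = 0` for every `g` with
`2 deg g + 2 ≤ N`. [cite: Potechin2019, Def. 2.14 (2) (p. 6) and Thm 5.12 (1) (p. 13)] -/
theorem storyFunctional_vertex_mul (i : Fin N) {g : MvPolynomial (KnEdge N) ℝ}
    (hg : 2 * g.totalDegree + 2 ≤ N) :
    storyFunctional N (((∑ e ∈ univ.filter (fun e : KnEdge N => i ∈ (e : Sym2 (Fin N))), X e) - 1) *
      g) = 0 := by
  classical
  conv_lhs => rw [g.as_sum, mul_sum]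
  rw [map_sum]
  refine sum_eq_zero fun β hβ => storyFunctional_vertex_mul_monomial i ?_ _
  have := card_edgeSupport_le_totalDegree hβ
  omega

/-- The vertex equation `Σ_{e ∋ i} X_e − 1` of `MOD2_N` has total degree `1` (for `N ≥ 2`, where
there is an edge at `i`). [cite: Grigoriev2001TCS, p. 621] -/
theorem totalDegree_system_vertex (hN : 2 ≤ N) (i : Fin N) :
    (Mod2.system N (Sum.inr (Sum.inr i))).totalDegree = 1 := by
  classical
  rw [system_vertex_eq]
  refine le_antisymm ?_ ?_
  · refine (totalDegree_sub _ _).trans (max_le ?_ (by rw [totalDegree_one]; exact Nat.zero_le _))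
    exact (totalDegree_finsetSum _ _).trans (Finset.sup_le fun e _ => (totalDegree_X (R := ℝ) e).le)
  · -- an edge at `i`
    obtain ⟨a, hai⟩ : ∃ a : Fin N, a ≠ i := by
      by_cases h0 : (i : ℕ) = 0
      · exact ⟨⟨1, by omega⟩, fun h => by have := congrArg Fin.val h; simp at this; omega⟩
      · exact ⟨⟨0, by omega⟩, fun h => by have := congrArg Fin.val h; simp at this; omega⟩
    set e₀ : KnEdge N := KnEdge.edgeAt i ⟨a, hai⟩ with he₀
    have hcoeff : coeff (Finsupp.single e₀ 1)
        ((∑ e ∈ univ.filter (fun e : KnEdge N => i ∈ (e : Sym2 (Fin N))), X e) - 1 :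
          MvPolynomial (KnEdge N) ℝ) = 1 := by
      rw [coeff_sub, coeff_sum, coeff_one, if_neg (Finsupp.single_ne_zero.2 one_ne_zero).symm, sub_zero]
      rw [sum_eq_single_of_mem e₀ (mem_filter.2 ⟨mem_univ _, KnEdge.mem_edgeAt i ⟨a, hai⟩⟩)]
      · rw [coeff_X, if_pos rfl]
      · intro e _ he
        rw [coeff_X, if_neg]
        intro h
        exact he (Finsupp.single_left_injective one_ne_zero h)
    have hmem : Finsupp.single e₀ 1 ∈
        ((∑ e ∈ univ.filter (fun e : KnEdge N => i ∈ (e : Sym2 (Fin N))), X e) - 1 :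
          MvPolynomial (KnEdge N) ℝ).support := by
      rw [mem_support_iff, hcoeff]; exact one_ne_zero
    refine le_trans ?_ (le_totalDegree hmem)
    simp

/-- **The story functional annihilates the MOD 2 ideal in the pseudo-expectation range**: for
`N ≥ 2` and `4d + 1 ≤ N`, `Ẽ[g · s_ι] = 0` for every equation `s_ι` of `MOD2_N` and every `g` with
`deg g + deg s_ι ≤ 2d` (Def. 2.14 (2) with Potechin-degree `2d`).
[cite: Potechin2019, Def. 2.14 (2) (p. 6), Thm 5.12 (1) (p. 13)] -/
theorem storyFunctional_ideal (hN : 2 ≤ N) {d : ℕ} (hd : 4 * d + 1 ≤ N) (ι : Mod2.Idx N)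
    (g : MvPolynomial (KnEdge N) ℝ) (hdeg : g.totalDegree + (Mod2.system N ι).totalDegree ≤ 2 * d) :
    storyFunctional N (g * Mod2.system N ι) = 0 := by
  rcases ι with e | p | i
  · rw [Mod2.system_edge, mul_comm]; exact storyFunctional_bool_mul e g
  · obtain ⟨hne, i, hi1, hi2⟩ := p.2
    rw [Mod2.system_pair, mul_comm]
    exact storyFunctional_pair_mul _ _ hne hi1 hi2 g
  · rw [totalDegree_system_vertex hN i] at hdeg
    rw [system_vertex_eq, mul_comm]
    exact storyFunctional_vertex_mul i (by omega)

/-! ### §4 Squares: `Ẽ[q²]` is the story moment form of the multilinear coefficient vector -/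

/-- The multilinear coefficient vector of `q`: `δ_G = Σ_{α : supp α = G} q_α` (the coefficients of
the multilinear reduction of `q` modulo `x_e² = x_e`). [cite: Potechin2019, Remark 2.16 (p. 6)] -/
def mlCoeff (q : MvPolynomial (KnEdge N) ℝ) (G : Finset (Sym2 (Fin N))) : ℝ :=
  ∑ α ∈ q.support.filter (fun α => edgeSupport α = G), coeff α q

/-- **`Ẽ[q²] = Σ_{G,G'} δ_G δ_{G'} Ẽ[x_{G ∪ G'}]`** with `δ` the multilinear coefficient vector of `q`
(the moment matrix quadratic form of Remark 2.16). [cite: Potechin2019, Remark 2.16 (p. 6)] -/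
theorem storyFunctional_mul_self (q : MvPolynomial (KnEdge N) ℝ) :
    storyFunctional N (q * q) = ∑ G : Finset (Sym2 (Fin N)), ∑ G' : Finset (Sym2 (Fin N)),
      mlCoeff q G * mlCoeff q G' * storyValue N (G ∪ G') := by
  classical
  rw [storyFunctional_mul]
  symm
  calc ∑ G : Finset (Sym2 (Fin N)), ∑ G' : Finset (Sym2 (Fin N)),
        mlCoeff q G * mlCoeff q G' * storyValue N (G ∪ G')
      = ∑ G : Finset (Sym2 (Fin N)), ∑ G' : Finset (Sym2 (Fin N)),
          ∑ α ∈ q.support.filter (fun α => edgeSupport α = G),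
          ∑ β ∈ q.support.filter (fun β => edgeSupport β = G'),
            coeff α q * coeff β q * storyValue N (edgeSupport α ∪ edgeSupport β) := by
        refine sum_congr rfl fun G _ => sum_congr rfl fun G' _ => ?_
        rw [mlCoeff, mlCoeff, sum_mul, sum_mul]
        refine sum_congr rfl fun α hα => ?_
        rw [mul_sum, sum_mul]
        refine sum_congr rfl fun β hβ => ?_
        rw [(mem_filter.1 hα).2, (mem_filter.1 hβ).2]
    _ = ∑ G : Finset (Sym2 (Fin N)), ∑ α ∈ q.support.filter (fun α => edgeSupport α = G),
          ∑ G' : Finset (Sym2 (Fin N)), ∑ β ∈ q.support.filter (fun β => edgeSupport β = G'),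
            coeff α q * coeff β q * storyValue N (edgeSupport α ∪ edgeSupport β) := by
        refine sum_congr rfl fun G _ => sum_comm
    _ = ∑ α ∈ q.support, ∑ β ∈ q.support,
          coeff α q * coeff β q * storyValue N (edgeSupport α ∪ edgeSupport β) := by
        rw [sum_fiberwise q.support (fun α => edgeSupport α)]
        refine sum_congr rfl fun α _ => ?_
        rw [sum_fiberwise q.support (fun β => edgeSupport β)]

/-- The multilinear coefficient vector of a polynomial of degree `≤ l` lives on edge sets of size
`≤ l`. [cite: Potechin2019, Remark 2.16 (p. 6)] -/
theorem mlCoeff_eq_zero_of_card_lt {q : MvPolynomial (KnEdge N) ℝ} {l : ℕ} (hq : q.totalDegree ≤ l)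
    {G : Finset (Sym2 (Fin N))} (hG : l < G.card) : mlCoeff q G = 0 := by
  refine sum_eq_zero fun α hα => ?_
  exfalso
  rw [mem_filter] at hα
  have := card_edgeSupport_le_totalDegree hα.1
  rw [hα.2] at this
  omega

/-- **Restriction of a kernel double sum to small edge sets**: if `δ` vanishes on edge sets with more
than `k` edges, `Σ_{G,G'} δ_G δ_{G'} K(G ∪ G')` is the same sum over `EdgeSets N k`.
[cite: Potechin2019, Remark 2.16 (p. 6)] -/
theorem sum_sum_eq_edgeSets {k : ℕ} (K : Finset (Sym2 (Fin N)) → ℝ) (δ : Finset (Sym2 (Fin N)) → ℝ)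
    (hδ : ∀ G, k < G.card → δ G = 0) :
    ∑ G : Finset (Sym2 (Fin N)), ∑ G' : Finset (Sym2 (Fin N)), δ G * δ G' * K (G ∪ G') =
      ∑ A : EdgeSets N k, ∑ B : EdgeSets N k, δ A.1 * δ B.1 * K (A.1 ∪ B.1) := by
  classical
  have hmem : ∀ F : Finset (Sym2 (Fin N)),
      F ∈ univ.filter (fun F : Finset (Sym2 (Fin N)) => F.card ≤ k) ↔ F.card ≤ k := fun F => by simp
  have hinner : ∀ G : Finset (Sym2 (Fin N)),
      ∑ G' : Finset (Sym2 (Fin N)), δ G * δ G' * K (G ∪ G') =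
        ∑ B : EdgeSets N k, δ G * δ B.1 * K (G ∪ B.1) := by
    intro G
    rw [← sum_filter_of_ne (s := (univ : Finset (Finset (Sym2 (Fin N)))))
      (p := fun F : Finset (Sym2 (Fin N)) => F.card ≤ k) (fun F _ hF => ?_),
      sum_subtype (F := inferInstance) _ hmem (fun G' => δ G * δ G' * K (G ∪ G'))]
    by_contra hc
    exact hF (by rw [hδ F (not_le.1 hc), mul_zero, zero_mul])
  simp_rw [hinner]
  rw [← sum_filter_of_ne (s := (univ : Finset (Finset (Sym2 (Fin N)))))
    (p := fun F : Finset (Sym2 (Fin N)) => F.card ≤ k) (fun F _ hF => ?_),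
    sum_subtype (F := inferInstance) _ hmem (fun G => ∑ B : EdgeSets N k, δ G * δ B.1 * K (G ∪ B.1))]
  by_contra hc
  exact hF (sum_eq_zero fun B _ => by rw [hδ F (not_le.1 hc), zero_mul, zero_mul])

/-- **`Ẽ[q²] ≥ 0` for `deg q ≤ d`, `6d ≤ N`, `N` odd — UNCONDITIONAL** (the tree's theorem
`storyForm_nonneg`). [cite: Potechin2019, Thm 1.2 (p. 4), Def. 2.14 (3) (p. 6)] -/
theorem storyFunctional_mul_self_nonneg (hN : Odd N) {d : ℕ} (hd : 6 * d ≤ N)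
    {q : MvPolynomial (KnEdge N) ℝ} (hq : q.totalDegree ≤ d) : 0 ≤ storyFunctional N (q * q) := by
  rw [storyFunctional_mul_self, sum_sum_eq_edgeSets (k := d) (storyValue N) (mlCoeff q)
    (fun G hG => mlCoeff_eq_zero_of_card_lt hq hG)]
  have h := storyForm_nonneg hN hd (fun A : EdgeSets N d => mlCoeff q A.1)
  unfold storyForm at h
  exact h

/-- The two tree spellings of the story values agree:
`PseudoMatching.storyValue N G = Mod2Story.storyMoment N G`. [cite: Potechin2019, Example 3.4 (p. 7)] -/
theorem storyValue_eq_storyMoment (G : Finset (Sym2 (Fin N))) :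
    storyValue N G = Mod2Story.storyMoment N G := by
  by_cases h : IsPartialMatching G
  · have h' : Mod2Story.IsPartialMatching G := h
    rw [storyValue_of h, Mod2Story.storyMoment_of_isPartialMatching h', moment_eq_inv_prod]
  · have h' : ¬ Mod2Story.IsPartialMatching G := h
    rw [storyValue_of_not h, Mod2Story.storyMoment_of_not_isPartialMatching h']

/-- **`Ẽ[q²] ≥ 0` for `deg q ≤ d`, `4d + 1 ≤ N`, `N` odd — from the named fact
`Potechin2019_mod2StoryPSD`** (the monomials of `q` have `≤ d` edges, hence index degree
`≤ 2d ≤ (N−1)/2`). [cite: Potechin2019, Thm 1.2 (p. 4), Cor. 3.10 (p. 9)] -/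
theorem storyFunctional_mul_self_nonneg_of_potechin (h : Mod2Story.Potechin2019_mod2StoryPSD)
    (hN : Odd N) {d : ℕ} (hd : 4 * d + 1 ≤ N) {q : MvPolynomial (KnEdge N) ℝ}
    (hq : q.totalDegree ≤ d) : 0 ≤ storyFunctional N (q * q) := by
  rw [storyFunctional_mul_self]
  simp_rw [storyValue_eq_storyMoment]
  refine h N hN (mlCoeff q) fun G hG => ?_
  have hGd : G.card ≤ d := by
    by_contra hc
    exact hG (mlCoeff_eq_zero_of_card_lt hq (not_le.1 hc))
  have := Mod2Story.card_verts_le_two_mul G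
  omega

/-! ### §5 The theorems -/

/-- **Potechin 2019, Theorem 1.2 in the range `6d ≤ N` — UNCONDITIONAL.** For odd `N ≥ 3` and
`6d ≤ N` the system `MOD2_N` ("`K_N` has a perfect matching") has NO static sum-of-squares
refutation of half-degree `d` (squares of degree `≤ d`, products of degree `≤ 2d`).  The story
functional is a degree-`2d` pseudo-expectation: `Ẽ[1] = 1`, it annihilates the ideal
(`storyFunctional_ideal`) and is nonnegative on squares (`storyFunctional_mul_self_nonneg`, from
`storyForm_nonneg`). [cite: Potechin2019, Thm 1.2 (p. 4) with Prop. 2.15 (p. 6)] -/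
theorem not_hasSOSRefutation_mod2 (hN : Odd N) (h3 : 3 ≤ N) {d : ℕ} (hd : 6 * d ≤ N) :
    ¬ HasSOSRefutation (Mod2.system N) d :=
  not_hasSOSRefutation_of_functional' (storyFunctional N) (by rw [storyFunctional_one]; exact one_pos)
    (fun _ hq => storyFunctional_mul_self_nonneg hN hd hq)
    fun ι g hdeg => storyFunctional_ideal (by omega) (d := d) (by omega) ι g hdeg

/-- **Potechin 2019, Theorem 1.2 verbatim ("Degree `(n−1)/2` SOS fails to prove that the equations
for the MOD 2 principle are infeasible"), from the named fact `Potechin2019_mod2StoryPSD`.** For odd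
`N ≥ 3` and `4d + 1 ≤ N` (i.e. Potechin-degree `2d ≤ (N−1)/2`), `MOD2_N` has no static sum-of-squares
refutation of half-degree `d`. [cite: Potechin2019, Thm 1.2 (p. 4) with Prop. 2.15 (p. 6)] -/
theorem not_hasSOSRefutation_mod2_of_potechin (h : Mod2Story.Potechin2019_mod2StoryPSD)
    (hN : Odd N) (h3 : 3 ≤ N) {d : ℕ} (hd : 4 * d + 1 ≤ N) :
    ¬ HasSOSRefutation (Mod2.system N) d :=
  not_hasSOSRefutation_of_functional' (storyFunctional N) (by rw [storyFunctional_one]; exact one_pos)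
    (fun _ hq => storyFunctional_mul_self_nonneg_of_potechin h hN hd hq)
    fun ι g hdeg => storyFunctional_ideal (by omega) hd ι g hdeg

/-- **Grigoriev's Corollary 2 with an explicit constant.** For every `n ≥ 2` and every `d`: if
`MOD2_n` has a static SOS refutation of half-degree `d` then `n < 6d` (for even `n` the system is
satisfiable and has no refutation at all; for odd `n` this is `not_hasSOSRefutation_mod2`).  The
threshold `n ≥ 2` is sharp (`MOD2_1` is refutable in half-degree `0`).
[cite: Grigoriev2001TCS, Cor. 2 (p. 622)] [cite: Potechin2019, Thm 1.2 (p. 4)] -/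
theorem lt_of_hasSOSRefutation_mod2 {n d : ℕ} (hn : 2 ≤ n) (h : HasSOSRefutation (Mod2.system n) d) :
    n < 6 * d := by
  rcases Nat.even_or_odd n with he | ho
  · obtain ⟨x, hx⟩ := Mod2.exists_common_zero_of_even he
    obtain ⟨ι, hι⟩ := h.no_common_zero x
    exact absurd (hx ι) hι
  · by_contra hc
    have h3 : 3 ≤ n := by obtain ⟨m, rfl⟩ := ho; omega
    exact not_hasSOSRefutation_mod2 ho h3 (not_lt.1 hc) h

/-- Under the Potechin fact: a half-degree-`d` refutation of `MOD2_n`, `n ≥ 2`, forces `n ≤ 4d`.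
[cite: Potechin2019, Thm 1.2 (p. 4)] -/
theorem le_of_hasSOSRefutation_mod2_of_potechin (hP : Mod2Story.Potechin2019_mod2StoryPSD) {n d : ℕ}
    (hn : 2 ≤ n) (h : HasSOSRefutation (Mod2.system n) d) : n ≤ 4 * d := by
  rcases Nat.even_or_odd n with he | ho
  · obtain ⟨x, hx⟩ := Mod2.exists_common_zero_of_even he
    obtain ⟨ι, hι⟩ := h.no_common_zero x
    exact absurd (hx ι) hι
  · by_contra hc
    have h3 : 3 ≤ n := by obtain ⟨m, rfl⟩ := ho; omega
    exact not_hasSOSRefutation_mod2_of_potechin hP ho h3 (by omega) h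

end PseudoMatching

/-- **The body of `Grigoriev2001_mod2Degree` with the explicit constants `c = 1/3`, `n₀ = 2`**
(independent of the Tseitin/expander route of `Grigoriev2001_mod2Degree_holds`, `Mod2SosDegreeProof.lean`,
whose constant is `9/(160·631¹⁶·(1 + 2 dX))` with threshold `56·631¹⁶·(1 + 2 dX)`): for every `n ≥ 2`,
every static SOS refutation of `MOD2_n` of half-degree `d` has `n/3 ≤ 2d`.
[cite: Grigoriev2001TCS, Cor. 2 (p. 622)] [cite: Potechin2019, Thm 1.2 (p. 4)] -/
theorem Grigoriev2001_mod2Degree_oneThird :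
    ∀ n : ℕ, 2 ≤ n → ∀ d : ℕ, HasSOSRefutation (Mod2.system n) d → (1 / 3 : ℝ) * n ≤ 2 * d := by
  intro n hn d h
  have hlt := PseudoMatching.lt_of_hasSOSRefutation_mod2 hn h
  have : ((n : ℕ) : ℝ) < ((6 * d : ℕ) : ℝ) := by exact_mod_cast hlt
  push_cast at this
  linarith

/-- **The cell's Rung 1 with explicit constant and no threshold** (BBCHPRRWZ §4.5 restriction +
Theorem 1.2): for even `n` and `U ⊆ [n]` with `2 ≤ |U|`, `2|U| ≤ n`, an SOS certificate of the
odd-cut slack `x(δ(U)) − 1 ≥ 0` of half-degree `d` from the matching constraints of `K_n` forces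
`|U| < 6d` — the Lasserre hierarchy over `𝒫_n` needs more than `|U|/6` rounds to derive the odd-set
inequality of `U`. [cite: BraunEtAl2016, §4.5 (p. 10)] [cite: Potechin2019, Thm 1.2 (p. 4)] -/
theorem card_lt_of_hasSOSCertificate_cutPoly {n : ℕ} (hn : Even n) (U : Finset (Fin n))
    (hU : 2 ≤ U.card) (h2 : 2 * U.card ≤ n) {d : ℕ}
    (h : HasSOSCertificate (Mod2.system n) (cutPoly U) d) : U.card < 6 * d :=
  PseudoMatching.lt_of_hasSOSRefutation_mod2 hU (hasSOSRefutation_of_hasSOSCertificate_cutPoly hn U h2 h)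

/-- The same under the Potechin fact, with the printed range: `|U| ≤ 4d`.
[cite: BraunEtAl2016, §4.5 (p. 10)] [cite: Potechin2019, Thm 1.2 (p. 4)] -/
theorem card_le_of_hasSOSCertificate_cutPoly_of_potechin
    (hP : Mod2Story.Potechin2019_mod2StoryPSD) {n : ℕ} (hn : Even n) (U : Finset (Fin n))
    (hU : 2 ≤ U.card) (h2 : 2 * U.card ≤ n) {d : ℕ}
    (h : HasSOSCertificate (Mod2.system n) (cutPoly U) d) : U.card ≤ 4 * d :=
  PseudoMatching.le_of_hasSOSRefutation_mod2_of_potechin hP hU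
    (hasSOSRefutation_of_hasSOSCertificate_cutPoly hn U h2 h)

/-- **The body of `OddCutSOSDegreeLinear` with the explicit constants `c = 1/3`, `t₀ = 2`** (the
∃-statement `oddCutSOSDegreeLinear` of `MatchingOddCutSosDegreeLinear.lean` inherits the Tseitin-route
constant; here the oddness of `|U|` is not even needed — for even `|U|` there is no certificate at all).
[cite: BraunEtAl2016, Thm. 4.11 with §4.5] [cite: Potechin2019, Thm 1.2 (p. 4)] -/
theorem oddCutSOSDegreeLinear_oneThird :
    ∀ n : ℕ, Even n → ∀ U : Finset (Fin n), 2 ≤ U.card → 2 * U.card ≤ n → ∀ d : ℕ,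
      HasSOSCertificate (Mod2.system n) (cutPoly U) d → (1 / 3 : ℝ) * U.card ≤ 2 * d := by
  intro n hn U hU h2 d h
  have hlt := card_lt_of_hasSOSCertificate_cutPoly hn U hU h2 h
  have : ((U.card : ℕ) : ℝ) < ((6 * d : ℕ) : ℝ) := by exact_mod_cast hlt
  push_cast at this
  linarith

end Literature.Computability.Complexity

end
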